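import Literature.NumberTheory.Sieve.DrappeauDispersionR1ppMoebius
import Mathlib.Data.Nat.Log
import HarnessLib

/-!
# Drappeau 2017, §5.5: flattening the piece sums and splitting the frequency `𝐧` into dyadic blocks

Topic `Literature/NumberTheory/Sieve`, part of the formalisation of §5 of S. Drappeau, Proc. London
Math. Soc. (3) 114 (2017) 684–732 = arXiv:1504.05549.  In the application of Theorem 2.1 on p. 20–21
the "rough" variable is `𝐧 ← a₁h(n₁−n₂)/q₀`, an integer of either sign with `0 < |𝐧| ≤ 𝐍`;
Theorem 2.1 wants `1 ≤ 𝐧 ≤ 𝐍` and a smooth weight with `∂_𝐧`-control, so the piece sums are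
split according to the sign `σ` of `𝐧` (the negative part is a complex conjugate of a sum of the
same shape) and dyadic blocks `2^k ≤ σ𝐧 < 2^{k+1}` (on which a plateau cut-off is `≡ 1`).
Everything proved; the definitions are the flattened / blocked piece sums and the integer `𝐧`.

* `nVar σ a₁ a₂ q₀ h n₁ n₂ = σ · sign(a₂) · a₁ · h · ((n₁ − n₂)/q₀)`;
* `pieceSumFlat` (one summand, five sums) and `pieceSum_eq_flat`;
* `pieceSumBlk … σ nlo nhi` (the extra condition `nlo ≤ 𝐧 < nhi`);
* `sum_sign_blocks_eq_one` — `∑_{σ=±1} ∑_{k<K} 1_{2^k ≤ σz < 2^{k+1}} = 1` for `0 < |z| < 2^K`;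
* `nVar_ne_zero` — `𝐧 ≠ 0` on the support (uses `1 ∉ B`, i.e. `n₀ ∉ (N, 2N]`);
* `pieceSumFlat_eq_sum_blocks` — `pieceSumFlat = ∑_{σ=±1} ∑_{k<K} pieceSumBlk σ 2^k 2^{k+1}`.

## References

* S. Drappeau, Proc. London Math. Soc. (3) 114 (2017) 684–732, arXiv:1504.05549, §5.5 p. 20–21.
  [cite: Drappeau2017, §5.5]
-/

noncomputable section

open Finset Real Complex
open scoped ArithmeticFunction.Moebius FourierTransform

namespace Literature.NumberTheory.Sieve

namespace Drappeau2017

/-- The rough variable `𝐧 = σ · sign(a₂) · a₁ · h · ((n₁ − n₂)/q₀)` of p. 20 (with the sign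
normalisations `σ` = sign of the block and `sign(a₂)` from `𝐫 = |a₂|n₀n₂`).
[cite: Drappeau2017, §5.5 p. 20] -/
def nVar (σ a₁ a₂ : ℤ) (q₀ : ℕ) (h : ℤ) (n₁ n₂ : ℕ) : ℤ :=
  σ * a₂.sign * a₁ * h * (((n₁ : ℤ) - n₂) / q₀)

/-- The flattened piece sum (one summand). [cite: Drappeau2017, §5.5, (5.23)] -/
def pieceSumFlat (a₁ a₂ : ℤ) (A₁ A₂ B : Finset ℕ) (q₀ n₀ l₁ l₂ : ℕ) (β : ℕ → ℂ) (ξ : ℝ)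
    (G : ℕ → ℕ → ℂ) (H : ℕ) : ℂ :=
  ∑ q₁ ∈ A₁, ∑ q₂ ∈ A₂, ∑ n₁ ∈ B, ∑ n₂ ∈ B,
    ∑ h ∈ (Finset.Icc (-(H : ℤ)) H).filter (fun h : ℤ => h ≠ 0),
      if (Nat.Coprime q₁ q₂ ∧ Nat.Coprime n₁ n₂ ∧ ((n₀ * n₁).Coprime (q₀ * q₁) ∧ (n₀ * n₂).Coprime (q₀ * q₂) ∧ n₁ ≡ n₂ [MOD q₀])) then
            G q₁ q₂ * (β (n₀ * n₁) * starRingEnd ℂ (β (n₀ * n₂))) *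
              ((𝐞 (-(ξ * h)) : ℂ) *
                ((𝐞 ((h : ℝ) * a₁ * ((((n₁ : ℤ) - n₂) / q₀ : ℤ)) *
                    ((((((q₁ : ℤ) * a₂ * n₀ * n₂ : ℤ) : ZMod (n₁ * q₂))⁻¹).val : ℕ) : ℝ) /
                      ((n₁ : ℝ) * q₂)) : ℂ) *
                  (𝐞 (-((h : ℝ) * a₁ *
                    ((((((q₀ : ℤ) * l₁ * l₂ * n₁ : ℤ) : ZMod (a₂.natAbs * n₀))⁻¹).val : ℕ) : ℝ) /
                      ((a₂ : ℝ) * n₀))) : ℂ)))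
      else 0

/-- The blocked piece sum: the flattened piece sum restricted to `nlo ≤ 𝐧 < nhi`,
`𝐧 = nVar σ a₁ a₂ q₀ h n₁ n₂`. [cite: Drappeau2017, §5.5 p. 20–21] -/
def pieceSumBlk (a₁ a₂ : ℤ) (A₁ A₂ B : Finset ℕ) (q₀ n₀ l₁ l₂ : ℕ) (β : ℕ → ℂ) (ξ : ℝ)
    (G : ℕ → ℕ → ℂ) (H : ℕ) (σ : ℤ) (nlo nhi : ℕ) : ℂ :=
  ∑ q₁ ∈ A₁, ∑ q₂ ∈ A₂, ∑ n₁ ∈ B, ∑ n₂ ∈ B,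
    ∑ h ∈ (Finset.Icc (-(H : ℤ)) H).filter (fun h : ℤ => h ≠ 0),
      if ((Nat.Coprime q₁ q₂ ∧ Nat.Coprime n₁ n₂ ∧ ((n₀ * n₁).Coprime (q₀ * q₁) ∧ (n₀ * n₂).Coprime (q₀ * q₂) ∧ n₁ ≡ n₂ [MOD q₀])) ∧
          (((nlo : ℕ) : ℤ) ≤ nVar σ a₁ a₂ q₀ h n₁ n₂ ∧ nVar σ a₁ a₂ q₀ h n₁ n₂ < ((nhi : ℕ) : ℤ))) then
            G q₁ q₂ * (β (n₀ * n₁) * starRingEnd ℂ (β (n₀ * n₂))) *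
              ((𝐞 (-(ξ * h)) : ℂ) *
                ((𝐞 ((h : ℝ) * a₁ * ((((n₁ : ℤ) - n₂) / q₀ : ℤ)) *
                    ((((((q₁ : ℤ) * a₂ * n₀ * n₂ : ℤ) : ZMod (n₁ * q₂))⁻¹).val : ℕ) : ℝ) /
                      ((n₁ : ℝ) * q₂)) : ℂ) *
                  (𝐞 (-((h : ℝ) * a₁ *
                    ((((((q₀ : ℤ) * l₁ * l₂ * n₁ : ℤ) : ZMod (a₂.natAbs * n₀))⁻¹).val : ℕ) : ℝ) /
                      ((a₂ : ℝ) * n₀))) : ℂ)))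
      else 0

/-- **Flattening**: `pieceSum = pieceSumFlat`. [folklore] -/
theorem pieceSum_eq_flat (a₁ a₂ : ℤ) (A₁ A₂ B : Finset ℕ) (q₀ n₀ l₁ l₂ : ℕ) (β : ℕ → ℂ) (ξ : ℝ)
    (G : ℕ → ℕ → ℂ) (H : ℕ) :
    pieceSum a₁ a₂ A₁ A₂ B q₀ n₀ l₁ l₂ β ξ G H = pieceSumFlat a₁ a₂ A₁ A₂ B q₀ n₀ l₁ l₂ β ξ G H := by
  unfold pieceSum pieceSumFlat
  refine Finset.sum_congr rfl fun q₁ _ => Finset.sum_congr rfl fun q₂ _ => ?_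
  rw [Finset.mul_sum]
  refine Finset.sum_congr rfl fun n₁ _ => ?_
  rw [Finset.mul_sum]
  refine Finset.sum_congr rfl fun n₂ _ => ?_
  by_cases hcop : (Nat.Coprime q₁ q₂ ∧ Nat.Coprime n₁ n₂)
  swap
  · rw [if_neg hcop, zero_mul, zero_mul, mul_zero]
    symm
    refine Finset.sum_eq_zero fun h _ => ?_
    rw [if_neg]
    exact fun h' => hcop ⟨h'.1, h'.2.1⟩
  rw [if_pos hcop]
  by_cases hc : ((n₀ * n₁).Coprime (q₀ * q₁) ∧ (n₀ * n₂).Coprime (q₀ * q₂) ∧ n₁ ≡ n₂ [MOD q₀])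
  swap
  · rw [if_neg hc, mul_zero, mul_zero]
    symm
    refine Finset.sum_eq_zero fun h _ => ?_
    rw [if_neg]
    exact fun h' => hc h'.2.2
  rw [if_pos hc, Finset.mul_sum, Finset.mul_sum]
  refine Finset.sum_congr rfl fun h _ => ?_
  rw [if_pos ⟨hcop.1, hcop.2, hc⟩]
  ring

/-! ### The sign / dyadic block partition of unity -/

/-- For `0 < |z| < 2^K`: exactly one pair `(σ, k) ∈ {1,−1} × [0,K)` has `2^k ≤ σz < 2^{k+1}`.
[folklore] -/
theorem sum_sign_blocks_eq_one {z : ℤ} (hz : z ≠ 0) {K : ℕ} (hK : z.natAbs < 2 ^ K) :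
    ∑ p ∈ ({1, -1} : Finset ℤ) ×ˢ Finset.range K,
      (if (((2 ^ p.2 : ℕ) : ℤ) ≤ p.1 * z ∧ p.1 * z < ((2 ^ (p.2 + 1) : ℕ) : ℤ)) then (1 : ℂ) else 0) = 1 := by
  rw [Finset.sum_product, Finset.sum_pair (by norm_num)]
  -- the block of `|z|`
  set k₀ := Nat.log 2 z.natAbs with hk₀
  have hzn : z.natAbs ≠ 0 := Int.natAbs_ne_zero.2 hz
  have hk₀K : k₀ < K := by
    by_contra h'
    have h1 : 2 ^ K ≤ 2 ^ k₀ := Nat.pow_le_pow_right (by norm_num) (not_lt.1 h')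
    exact absurd (lt_of_lt_of_le hK (h1.trans (Nat.pow_log_le_self 2 hzn))) (lt_irrefl _)
  have hblk : ∀ k : ℕ, (2 ^ k ≤ z.natAbs ∧ z.natAbs < 2 ^ (k + 1)) ↔ k = k₀ := by
    intro k
    rw [hk₀, eq_comm, Nat.log_eq_iff (Or.inr ⟨by norm_num, hzn⟩)]
  -- the one-sided sums
  have hside : ∀ w : ℤ, (w.natAbs = z.natAbs) → 0 < w →
      ∑ k ∈ Finset.range K, (if (((2 ^ k : ℕ) : ℤ) ≤ w ∧ w < ((2 ^ (k + 1) : ℕ) : ℤ)) then (1 : ℂ) else 0)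
        = 1 := by
    intro w hw hwpos
    have hwc : ((w.natAbs : ℕ) : ℤ) = w := Int.natAbs_of_nonneg hwpos.le
    rw [Finset.sum_eq_single_of_mem k₀ (Finset.mem_range.2 hk₀K)]
    · rw [if_pos]
      have h1 := (hblk k₀).2 rfl
      rw [← hw] at h1
      constructor <;> [skip; skip] <;> omega
    · intro k _ hk
      rw [if_neg]
      intro h'
      apply hk
      rw [← hblk k, ← hw]
      constructor <;> omega
  have hneg : ∀ w : ℤ, w < 0 →
      ∑ k ∈ Finset.range K, (if (((2 ^ k : ℕ) : ℤ) ≤ w ∧ w < ((2 ^ (k + 1) : ℕ) : ℤ)) then (1 : ℂ) else 0)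
        = 0 := by
    intro w hw
    refine Finset.sum_eq_zero fun k _ => ?_
    rw [if_neg]
    intro h'
    have : (0 : ℤ) < ((2 ^ k : ℕ) : ℤ) := by positivity
    omega
  rcases lt_or_gt_of_ne hz with hlt | hgt
  · rw [hneg (1 * z) (by omega), hside (-1 * z) (by simp) (by omega)]; simp
  · rw [hside (1 * z) (by simp) (by omega), hneg (-1 * z) (by omega)]; simp

/-- **`𝐧 ≠ 0` on the support.**  If `(n₁, n₂) = 1`, `n₁ ≡ n₂ (mod q₀)`, `n₁, n₂ ∈ B ∌ 1`, `h ≠ 0`,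
`a₁a₂ ≠ 0`, `σ = ±1`, then `nVar σ a₁ a₂ q₀ h n₁ n₂ ≠ 0`. [cite: Drappeau2017, §5.5 p. 20] -/
theorem nVar_ne_zero {σ a₁ a₂ : ℤ} (hσ : σ = 1 ∨ σ = -1) (ha₁ : a₁ ≠ 0) (ha₂ : a₂ ≠ 0) {q₀ : ℕ}
    (hq₀ : 0 < q₀) {h : ℤ} (hh : h ≠ 0) {B : Finset ℕ} (hB : (1 : ℕ) ∉ B) {n₁ n₂ : ℕ} (hn₁ : n₁ ∈ B)
    (hcop : Nat.Coprime n₁ n₂) (hmod : n₁ ≡ n₂ [MOD q₀]) : nVar σ a₁ a₂ q₀ h n₁ n₂ ≠ 0 := by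
  unfold nVar
  have hne : n₁ ≠ n₂ := by
    rintro rfl
    rw [Nat.coprime_self] at hcop
    rw [hcop] at hn₁
    exact hB hn₁
  have hdvd : (q₀ : ℤ) ∣ (n₁ : ℤ) - n₂ := (Nat.modEq_iff_dvd.1 hmod.symm)
  have ht : ((n₁ : ℤ) - n₂) / q₀ ≠ 0 := by
    intro h0
    obtain ⟨c, hc⟩ := hdvd
    rw [hc, Int.mul_ediv_cancel_left _ (by exact_mod_cast hq₀.ne')] at h0
    rw [h0, mul_zero, sub_eq_zero] at hc
    exact hne (by exact_mod_cast hc)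
  have hσ0 : σ ≠ 0 := by rcases hσ with rfl | rfl <;> norm_num
  have hs : a₂.sign ≠ 0 := fun h' => ha₂ (Int.sign_eq_zero_iff_zero.1 h')
  exact mul_ne_zero (mul_ne_zero (mul_ne_zero (mul_ne_zero hσ0 hs) ha₁) hh) ht

/-- **Block decomposition**: `pieceSumFlat = ∑_{σ = ±1} ∑_{k < K} pieceSumBlk σ 2^k 2^{k+1}` as soon
as `1 ∉ B`, `a₁a₂ ≠ 0` and `|a₁ h (n₁−n₂)/q₀| < 2^K` throughout. [cite: Drappeau2017, §5.5 p. 20–21] -/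
theorem pieceSumFlat_eq_sum_blocks (a₁ a₂ : ℤ) (A₁ A₂ B : Finset ℕ) {q₀ : ℕ} (n₀ l₁ l₂ : ℕ)
    (β : ℕ → ℂ) (ξ : ℝ) (G : ℕ → ℕ → ℂ) (H : ℕ) (ha₁ : a₁ ≠ 0) (ha₂ : a₂ ≠ 0) (hq₀ : 0 < q₀)
    (hB : (1 : ℕ) ∉ B) {K : ℕ}
    (hK : ∀ n₁ ∈ B, ∀ n₂ ∈ B, ∀ h ∈ Finset.Icc (-(H : ℤ)) H,
      (a₁ * h * (((n₁ : ℤ) - n₂) / q₀)).natAbs < 2 ^ K) :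
    pieceSumFlat a₁ a₂ A₁ A₂ B q₀ n₀ l₁ l₂ β ξ G H =
      ∑ p ∈ ({1, -1} : Finset ℤ) ×ˢ Finset.range K,
        pieceSumBlk a₁ a₂ A₁ A₂ B q₀ n₀ l₁ l₂ β ξ G H p.1 (2 ^ p.2) (2 ^ (p.2 + 1)) := by
  unfold pieceSumFlat pieceSumBlk
  simp only [Finset.sum_comm (s := ({1, -1} : Finset ℤ) ×ˢ Finset.range K)]
  refine Finset.sum_congr rfl fun q₁ _ => Finset.sum_congr rfl fun q₂ _ =>
    Finset.sum_congr rfl fun n₁ hn₁ => Finset.sum_congr rfl fun n₂ hn₂ =>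
    Finset.sum_congr rfl fun h hh => ?_
  rw [Finset.mem_filter] at hh
  by_cases hc : (Nat.Coprime q₁ q₂ ∧ Nat.Coprime n₁ n₂ ∧ ((n₀ * n₁).Coprime (q₀ * q₁) ∧ (n₀ * n₂).Coprime (q₀ * q₂) ∧ n₁ ≡ n₂ [MOD q₀]))
  swap
  · rw [if_neg hc]
    refine (Finset.sum_eq_zero fun p _ => ?_).symm
    rw [if_neg (fun h' => hc h'.1)]
  rw [if_pos hc]
  have hz : nVar 1 a₁ a₂ q₀ h n₁ n₂ ≠ 0 :=
    nVar_ne_zero (Or.inl rfl) ha₁ ha₂ hq₀ hh.2 hB hn₁ hc.2.1 hc.2.2.2.2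
  have hzK : (nVar 1 a₁ a₂ q₀ h n₁ n₂).natAbs < 2 ^ K := by
    have h1 := hK n₁ hn₁ n₂ hn₂ h hh.1
    unfold nVar
    rw [Int.natAbs_mul, Int.natAbs_mul, Int.natAbs_mul, Int.natAbs_mul, Int.natAbs_one,
      Int.natAbs_sign_of_ne_zero ha₂, one_mul, one_mul]
    rwa [Int.natAbs_mul, Int.natAbs_mul] at h1
  have key := sum_sign_blocks_eq_one hz hzK
  have hnv : ∀ p : ℤ × ℕ, nVar p.1 a₁ a₂ q₀ h n₁ n₂ = p.1 * nVar 1 a₁ a₂ q₀ h n₁ n₂ := by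
    intro p; unfold nVar; ring
  calc _ = (G q₁ q₂ * (β (n₀ * n₁) * starRingEnd ℂ (β (n₀ * n₂))) *
              ((𝐞 (-(ξ * h)) : ℂ) *
                ((𝐞 ((h : ℝ) * a₁ * ((((n₁ : ℤ) - n₂) / q₀ : ℤ)) *
                    ((((((q₁ : ℤ) * a₂ * n₀ * n₂ : ℤ) : ZMod (n₁ * q₂))⁻¹).val : ℕ) : ℝ) /
                      ((n₁ : ℝ) * q₂)) : ℂ) *
                  (𝐞 (-((h : ℝ) * a₁ *
                    ((((((q₀ : ℤ) * l₁ * l₂ * n₁ : ℤ) : ZMod (a₂.natAbs * n₀))⁻¹).val : ℕ) : ℝ) /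
                      ((a₂ : ℝ) * n₀))) : ℂ)))) * ∑ p ∈ ({1, -1} : Finset ℤ) ×ˢ Finset.range K,
        (if (((2 ^ p.2 : ℕ) : ℤ) ≤ p.1 * nVar 1 a₁ a₂ q₀ h n₁ n₂ ∧
          p.1 * nVar 1 a₁ a₂ q₀ h n₁ n₂ < ((2 ^ (p.2 + 1) : ℕ) : ℤ)) then (1 : ℂ) else 0) := by
          rw [key, mul_one]
    _ = _ := by
          rw [Finset.mul_sum]
          refine Finset.sum_congr rfl fun p _ => ?_
          rw [← hnv p]
          by_cases hb : (((2 ^ p.2 : ℕ) : ℤ) ≤ nVar p.1 a₁ a₂ q₀ h n₁ n₂ ∧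
              nVar p.1 a₁ a₂ q₀ h n₁ n₂ < ((2 ^ (p.2 + 1) : ℕ) : ℤ))
          · rw [if_pos hb, if_pos ⟨hc, hb⟩, mul_one]
          · rw [if_neg hb, if_neg (fun h' => hb h'.2), mul_zero]

end Drappeau2017

end Literature.NumberTheory.Sieve

end
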